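import Mathlib.NumberTheory.Real.Irrational
import Literature.ModelTheory.Zilber.EACRotundityProofs
import Literature.ModelTheory.Zilber.EACAperiodicBase
import Literature.ModelTheory.Zilber.EACQuadricBases
import HarnessLib

/-!
# EAC: certified members of the APERIODIC sub-cell, and hyperplane bases

Part of the Exponential-Algebraic Closedness (EAC) ladder (`Literature.ModelTheory.Zilber.EAC`,
cells `ECCell n d`; first OPEN cell `(3, 2)`). Sorry-free; no named facts; no conjecture is asserted.

`EACAperiodicBase` splits `ECCell (d + 1) d ↔ ECCellAperiodic d ∧ ECCellPeriodic d` according to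
whether the base `cl π(V)` — a hypersurface — has a nonzero integer translation period, and proves
that on the aperiodic side rotundity is automatic. `EACRotundityProofs` certifies the graph-base
families `decoupledGraph`, `fibredGraph`, `polyFibredGraph` (fibres over the base `x_{s+1} = g(x')`)
as members of `ECCell (s + 1) s`. This file joins the two:

1. `vanishingIdeal_graphBase`: `I({x_{s+1} = g(x')}) = ker (X_{s+1} ↦ g)`; hence for each family
   the additive projection of the torus part has the SAME vanishing ideal as `graphBase g`
   (`EACRotundityProofs.vanishingIdeal_projAdd_*`), and periodicity of the base of the variety is
   periodicity of `graphBase g` (`hasIntegerPeriod_projAdd_decoupledGraph_iff`, `…fibredGraph_iff`,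
   `…polyFibredGraph_iff`), decided by `hasIntegerPeriod_graphBase_iff`.
2. The four model systems of the open rung `(3, 2)` typed in `EACRotundityProofs` —
   Mantova–Masser's `x₃ = x₁² - x₂²` (`mantovaMasserModel`), the cubic `x₃ = x₁³ + x₂³`
   (`cubicOscillatoryModel`), the imaginary quadric `x₃ = i x₁ x₂` (`imaginaryQuadricModel`) and the
   mismatch paraboloid `x₃ = -x₁² - x₂²` (`mismatchParaboloidModel`) — all have APERIODIC bases
   (test-point computations), so they satisfy every hypothesis of the rotundity-free sub-cell
   `ECCellAperiodic 2` (`ecCellAperiodic_hypotheses_*`), and `ECCellAperiodic 2` alone implies that each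
   meets the graph of `exp` (`*_inter_expGraph_nonempty_of_ecCellAperiodic`).
2'. The PERIODIC sub-cell is not empty of certified members either: the parabolic-cylinder model
   `x₃ = x₁², y₁ = x₁ - y₃, y₂ = x₂ - y₃` (`parabolicCylinderModel`, base period `(0, 1, 0)`,
   rotund through its dominant multiplicative projection) satisfies every hypothesis of
   `ECCellPeriodic 2` (`ecCellPeriodic_hypotheses_parabolicCylinderModel`); its system is
   `e^z + e^{z²} = z, e^w + e^{z²} = w` (`parabolicCylinderModel_inter_expGraph_nonempty_iff`).
3. HYPERPLANE bases `x_{s+1} = Σ rᵢ xᵢ + c` (degree one, excluded by the `deg g ≥ 2` hypothesis of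
   `EACRotundityProofs.ecCell_hypotheses_polyFibredGraph`): additive freeness holds as soon as some
   `rⱼ` is irrational (`isAddFree_of_vanishingIdeal_projAdd_eq_ker_linear`), giving the membership
   certificate `ecCell_hypotheses_polyFibredGraph_linear` for `W(ℓ; A, F)` with `A` dominant — the
   shape of the real-hyperplane family of `Summits/…/ZilberEacComplexRealHyperplane` (whose bases
   are periodic or aperiodic according to `EACAperiodicBase.hasIntegerPeriod_graphBase_linear_iff`);
   in particular seat 2's `√2`-model `x₃ = √2 x₁ - x₂, y₁ = x₁ + y₃, y₂ = x₂² + y₃`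
   (`sqrtTwoHyperplaneModel`; `A = (X₀, X₁²)` dominant by `aeval_injective_of_surjective`) is a
   certified member of `ECCell 3 2`, with PERIODIC base (period `(0, 1, -1)`), hence of
   `ECCellPeriodic 2`, and its system `e^z = z + e^{√2 z - w}, e^w = w² + e^{√2 z - w}` is solved in the
   tree (`Summit.Schanuel.Schanuel.Theorems.sqrt_two_hyperplane_model_system_solvable`).

4. Seat 2's QUADRIC ESCAPE FAMILY (`Summits/…/ZilberEacComplexQuadricEscape`:
   `x_{s+1} = Σ aᵢxᵢ² + Σ bᵢxᵢ + c₀`, `yⱼ = cⱼ y_{s+1} + Aⱼ(x′)`) is literally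
   `polyFibredGraph g A (C ∘ c)` (`quadricEscapeVariety`); with `A` dominant it is a member of
   `ECCellAperiodic s` when all `aᵢ ≠ 0` (`ecCellAperiodic_hypotheses_quadricEscapeVariety`, additive
   freeness supplied by `EACAperiodicBase.isAddFree_of_not_hasIntegerPeriod`, no degree bookkeeping)
   and of `ECCellPeriodic s` when some `aₖ = 0` with `bₖ ∈ ℤ` (`ecCellPeriodic_hypotheses_…`), by the
   criteria of `EACQuadricBases`: one existence theorem of the tree populates BOTH sub-cells.

## What is NOT here

No case of `ECCell 3 2`, `ECCellAperiodic 2` or `ECCellPeriodic 2` is proved (all OPEN: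
Mantova–Masser 2024 §1; Aslanyan–Gallinaro 2024 §3.4–3.5); the solvability of the model systems is
proved elsewhere in the tree (`Summits/Schanuel/Schanuel/Theorems/ZilberEacComplex*`) and is not
used here. Nothing here bears on Schanuel's conjecture (EAC is a different statement; EAC ⇏ SC).

Sources: Mantova–Masser 2024 (MantovaMasser2023, arXiv:2303.05592) §1 p. 5 (model system, open
case); Aslanyan–Gallinaro 2024 (arXiv:2409.12860) Def. 3.3, §3.2; Bays–Kirby 2018 Def. 7.1; Zilber
2005 §3 (freeness, rotundity).
-/

noncomputable section

open MvPolynomial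

namespace Literature.ModelTheory.Zilber

open Literature.NumberTheory.Transcendental

/-! ### The ideal of a graph base -/

section GraphIdeal

variable {s : ℕ} (g : MvPolynomial (Fin s) ℂ)

/-- **`I({x_{s+1} = g(x')}) = ker (X_{s+1} ↦ g)`**: a polynomial vanishes on the graph of `g` iff
the substitution `X_{s+1} ↦ g(X')` kills it. [folklore] -/
theorem vanishingIdeal_graphBase :
    vanishingIdeal ℂ (graphBase g) = RingHom.ker (aeval (graphSubst g) :
      MvPolynomial (Fin (s + 1)) ℂ →ₐ[ℂ] MvPolynomial (Fin s) ℂ) := by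
  ext p
  rw [mem_vanishingIdeal_iff, RingHom.mem_ker]
  constructor
  · intro h
    apply MvPolynomial.funext
    intro x
    rw [eval_aeval_graphSubst, map_zero]
    exact h _ (by simp [graphBase])
  · intro h x hx
    have hx' : x = (Fin.snoc (fun i => x (Fin.castSucc i)) (eval (fun i => x (Fin.castSucc i)) g) :
        Fin (s + 1) → ℂ) := by
      funext i
      induction i using Fin.lastCases with
      | last => rw [Fin.snoc_last]; exact hx
      | cast j => rw [Fin.snoc_castSucc]
    rw [hx', ← eval_aeval_graphSubst, h, map_zero]

/-- Periodicity depends only on the vanishing ideal. [folklore] -/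
theorem hasIntegerPeriod_congr {F : Type*} [Field F] {n : ℕ} {S T : Set (Fin n → F)}
    (h : vanishingIdeal F S = vanishingIdeal F T) : HasIntegerPeriod F S ↔ HasIntegerPeriod F T := by
  simp only [HasIntegerPeriod, h]

/-- The base of `W(g; a, b, f) ∩ Gⁿ` is periodic iff `graphBase g` is (all `aⱼ ≠ 0`). [folklore] -/
theorem hasIntegerPeriod_projAdd_decoupledGraph_iff (a b f : Fin s → ℂ) (ha : ∀ j, a j ≠ 0) :
    HasIntegerPeriod ℂ (projAdd '' (decoupledGraph g a b f ∩ torusLocus ℂ (s + 1))) ↔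
      HasIntegerPeriod ℂ (graphBase g) :=
  hasIntegerPeriod_congr (by rw [vanishingIdeal_projAdd_decoupledGraph g a b f ha,
    vanishingIdeal_graphBase])

/-- The base of `W(g; a, b, F) ∩ Gⁿ` is periodic iff `graphBase g` is (all `aⱼ ≠ 0`). [folklore] -/
theorem hasIntegerPeriod_projAdd_fibredGraph_iff (a b : Fin s → ℂ)
    (F : Fin s → MvPolynomial (Fin (s + 1)) ℂ) (ha : ∀ j, a j ≠ 0) :
    HasIntegerPeriod ℂ (projAdd '' (fibredGraph g a b F ∩ torusLocus ℂ (s + 1))) ↔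
      HasIntegerPeriod ℂ (graphBase g) :=
  hasIntegerPeriod_congr (by rw [vanishingIdeal_projAdd_fibredGraph g a b F ha,
    vanishingIdeal_graphBase])

/-- The base of `W(g; A, F) ∩ Gⁿ` is periodic iff `graphBase g` is (`A` dominant). [folklore] -/
theorem hasIntegerPeriod_projAdd_polyFibredGraph_iff (A : Fin s → MvPolynomial (Fin s) ℂ)
    (F : Fin s → MvPolynomial (Fin (s + 1)) ℂ)
    (hA : Function.Injective (aeval A : MvPolynomial (Fin s) ℂ →ₐ[ℂ] MvPolynomial (Fin s) ℂ)) :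
    HasIntegerPeriod ℂ (projAdd '' (polyFibredGraph g A F ∩ torusLocus ℂ (s + 1))) ↔
      HasIntegerPeriod ℂ (graphBase g) :=
  hasIntegerPeriod_congr (by rw [vanishingIdeal_projAdd_polyFibredGraph g A F hA,
    vanishingIdeal_graphBase])

/-- **Test-point criterion for aperiodicity of a graph base**: if the functional equation
`g(x' + w') = g(x') + w_{s+1}` (all `x'`) forces `w = 0`, then `graphBase g` is aperiodic.
[folklore] -/
theorem not_hasIntegerPeriod_graphBase_of_tests
    (h : ∀ w : Fin (s + 1) → ℤ,
      (∀ x : Fin s → ℂ, eval (fun i => x i + (w (Fin.castSucc i) : ℂ)) g =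
        eval x g + (w (Fin.last s) : ℂ)) → w = 0) :
    ¬ HasIntegerPeriod ℂ (graphBase g) := by
  rw [hasIntegerPeriod_graphBase_iff]
  rintro ⟨w, hw, heq⟩
  refine hw (h w fun x => ?_)
  have := congrArg (eval x) heq
  rw [eval_transl, map_add, eval_C] at this
  exact this

end GraphIdeal

/-! ### The four model bases of the open rung `(3, 2)` are aperiodic -/

section ModelBases

/-- `2 v = 0` in `ℂ` forces the integer `v` to vanish. [folklore] -/
private theorem int_eq_zero_of_two_mul {v : ℤ} (h : (2 : ℂ) * (v : ℂ) = 0) : v = 0 := by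
  exact_mod_cast (mul_eq_zero.1 h).resolve_left two_ne_zero

/-- `x₃ = x₁² - x₂²` (Mantova–Masser) is aperiodic: `graphBase (X₀² - X₁²) = mmBase`-shaped test
points `0, e₁, e₂`. [folklore] -/
theorem not_hasIntegerPeriod_graphBase_mm :
    ¬ HasIntegerPeriod ℂ (graphBase (X 0 ^ 2 - X 1 ^ 2 : MvPolynomial (Fin 2) ℂ)) := by
  refine not_hasIntegerPeriod_graphBase_of_tests _ fun w hw => ?_
  have e0 := hw 0
  have e1 := hw ![1, 0]
  have e2 := hw ![0, 1]
  simp only [map_sub, map_pow, eval_X, Pi.zero_apply, zero_add, Matrix.cons_val_zero,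
    Matrix.cons_val_one] at e0 e1 e2
  have hc0 : (Fin.castSucc (0 : Fin 2) : Fin 3) = 0 := rfl
  have hc1 : (Fin.castSucc (1 : Fin 2) : Fin 3) = 1 := rfl
  have hl : (Fin.last 2 : Fin 3) = 2 := rfl
  rw [hc0, hc1, hl] at e0 e1 e2
  have g0 : w 0 = 0 := int_eq_zero_of_two_mul (by linear_combination e1 - e0)
  have g1 : w 1 = 0 := int_eq_zero_of_two_mul (by linear_combination e0 - e2)
  have g2 : w 2 = 0 := by
    rw [g0, g1] at e0
    have : ((w 2 : ℤ) : ℂ) = 0 := by simpa using e0.symm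
    exact_mod_cast this
  funext i
  fin_cases i
  · exact g0
  · exact g1
  · exact g2

/-- `x₃ = -x₁² - x₂²` (the mismatch paraboloid) is aperiodic. [folklore] -/
theorem not_hasIntegerPeriod_graphBase_mismatch :
    ¬ HasIntegerPeriod ℂ (graphBase (-X 0 ^ 2 - X 1 ^ 2 : MvPolynomial (Fin 2) ℂ)) := by
  refine not_hasIntegerPeriod_graphBase_of_tests _ fun w hw => ?_
  have e0 := hw 0
  have e1 := hw ![1, 0]
  have e2 := hw ![0, 1]
  simp only [map_sub, map_neg, map_pow, eval_X, Pi.zero_apply, zero_add, Matrix.cons_val_zero,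
    Matrix.cons_val_one] at e0 e1 e2
  have hc0 : (Fin.castSucc (0 : Fin 2) : Fin 3) = 0 := rfl
  have hc1 : (Fin.castSucc (1 : Fin 2) : Fin 3) = 1 := rfl
  have hl : (Fin.last 2 : Fin 3) = 2 := rfl
  rw [hc0, hc1, hl] at e0 e1 e2
  have g0 : w 0 = 0 := int_eq_zero_of_two_mul (by linear_combination e0 - e1)
  have g1 : w 1 = 0 := int_eq_zero_of_two_mul (by linear_combination e0 - e2)
  have g2 : w 2 = 0 := by
    rw [g0, g1] at e0
    have : ((w 2 : ℤ) : ℂ) = 0 := by simpa using e0.symm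
    exact_mod_cast this
  funext i
  fin_cases i
  · exact g0
  · exact g1
  · exact g2

/-- `x₃ = i x₁ x₂` (the imaginary quadric) is aperiodic. [folklore] -/
theorem not_hasIntegerPeriod_graphBase_imaginary :
    ¬ HasIntegerPeriod ℂ (graphBase (C Complex.I * X 0 * X 1 : MvPolynomial (Fin 2) ℂ)) := by
  refine not_hasIntegerPeriod_graphBase_of_tests _ fun w hw => ?_
  have e0 := hw 0
  have e1 := hw ![1, 0]
  have e2 := hw ![0, 1]
  simp only [map_mul, eval_C, eval_X, Pi.zero_apply, zero_add, Matrix.cons_val_zero,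
    Matrix.cons_val_one] at e0 e1 e2
  have hc0 : (Fin.castSucc (0 : Fin 2) : Fin 3) = 0 := rfl
  have hc1 : (Fin.castSucc (1 : Fin 2) : Fin 3) = 1 := rfl
  have hl : (Fin.last 2 : Fin 3) = 2 := rfl
  rw [hc0, hc1, hl] at e0 e1 e2
  -- e0 : I w₀ w₁ = w₂ ; e1 : I (1 + w₀) w₁ = w₂ ; e2 : I w₀ (1 + w₁) = w₂
  have f1 : Complex.I * (w 1 : ℂ) = 0 := by linear_combination e1 - e0
  have f0 : Complex.I * (w 0 : ℂ) = 0 := by linear_combination e2 - e0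
  have g1 : w 1 = 0 := by exact_mod_cast (mul_eq_zero.1 f1).resolve_left Complex.I_ne_zero
  have g0 : w 0 = 0 := by exact_mod_cast (mul_eq_zero.1 f0).resolve_left Complex.I_ne_zero
  have g2 : w 2 = 0 := by
    rw [g0, g1] at e0
    have : ((w 2 : ℤ) : ℂ) = 0 := by simpa using e0.symm
    exact_mod_cast this
  funext i
  fin_cases i
  · exact g0
  · exact g1
  · exact g2

/-- `x₃ = x₁³ + x₂³` (the cubic oscillatory model) is aperiodic. [folklore] -/
theorem not_hasIntegerPeriod_graphBase_cubic :
    ¬ HasIntegerPeriod ℂ (graphBase (X 0 ^ 3 + X 1 ^ 3 : MvPolynomial (Fin 2) ℂ)) := by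
  refine not_hasIntegerPeriod_graphBase_of_tests _ fun w hw => ?_
  have e0 := hw 0
  have e1 := hw ![1, 0]
  have e1' := hw ![-1, 0]
  have e2 := hw ![0, 1]
  have e2' := hw ![0, -1]
  simp only [map_add, map_pow, eval_X, Pi.zero_apply, zero_add, Matrix.cons_val_zero,
    Matrix.cons_val_one] at e0 e1 e1' e2 e2'
  have hc0 : (Fin.castSucc (0 : Fin 2) : Fin 3) = 0 := rfl
  have hc1 : (Fin.castSucc (1 : Fin 2) : Fin 3) = 1 := rfl
  have hl : (Fin.last 2 : Fin 3) = 2 := rfl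
  rw [hc0, hc1, hl] at e0 e1 e1' e2 e2'
  -- (1+w₀)³ + (-1+w₀)³ - 2 w₀³ = 6 w₀  etc.
  have f0 : (6 : ℂ) * (w 0 : ℂ) = 0 := by linear_combination e1 + e1' - 2 * e0
  have f1 : (6 : ℂ) * (w 1 : ℂ) = 0 := by linear_combination e2 + e2' - 2 * e0
  have g0 : w 0 = 0 := by exact_mod_cast (mul_eq_zero.1 f0).resolve_left (by norm_num)
  have g1 : w 1 = 0 := by exact_mod_cast (mul_eq_zero.1 f1).resolve_left (by norm_num)
  have g2 : w 2 = 0 := by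
    rw [g0, g1] at e0
    have : ((w 2 : ℤ) : ℂ) = 0 := by simpa using e0.symm
    exact_mod_cast this
  funext i
  fin_cases i
  · exact g0
  · exact g1
  · exact g2

end ModelBases

/-! ### The four model varieties satisfy every hypothesis of the rotundity-free sub-cell -/

/-- The coefficient vector `(1, -1)` has no zero entry. [folklore] -/
private theorem mm_ha : ∀ j : Fin 2, (![(1 : ℂ), -1]) j ≠ 0 := fun j => by fin_cases j <;> simp
/-- The coefficient vector `(1, 1)` has no zero entry. [folklore] -/
private theorem pp_ha : ∀ j : Fin 2, (![(1 : ℂ), 1]) j ≠ 0 := fun j => by fin_cases j <;> simp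

section Models

/-- **Mantova–Masser's model variety satisfies every hypothesis of `ECCellAperiodic 2`** — in the
binder order of that cell: irreducible closed, meets `G³`, additively free, multiplicatively free,
`dim = 3`, `addProjDim = 2`, base aperiodic. (No rotundity clause: in this sub-cell it is
automatic.) [folklore] -/
theorem ecCellAperiodic_hypotheses_mantovaMasserModel :
    IsIrreducibleClosed ℂ mantovaMasserModel ∧
    (mantovaMasserModel ∩ torusLocus ℂ 3).Nonempty ∧
    IsAddFree ℂ 3 (mantovaMasserModel ∩ torusLocus ℂ 3) ∧
    IsMulFree ℂ 3 (mantovaMasserModel ∩ torusLocus ℂ 3) ∧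
    zariskiDim ℂ mantovaMasserModel = (3 : ℕ) ∧
    addProjDim ℂ 3 mantovaMasserModel = (2 : ℕ) ∧
    ¬ HasIntegerPeriod ℂ (projAdd '' (mantovaMasserModel ∩ torusLocus ℂ 3)) := by
  obtain ⟨h1, h2, -, h4, h5, h6, h7⟩ := ecCell_hypotheses_mantovaMasserModel
  refine ⟨h1, h2, h4, h5, h6, h7, ?_⟩
  rw [show mantovaMasserModel = decoupledGraph (X 0 ^ 2 - X 1 ^ 2 : MvPolynomial (Fin 2) ℂ)
      ![1, -1] ![0, 0] ![-1, -1] from rfl,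
    hasIntegerPeriod_projAdd_decoupledGraph_iff _ _ _ _ mm_ha]
  exact not_hasIntegerPeriod_graphBase_mm

/-- **`ECCellAperiodic 2` (the rotundity-free open sub-rung) implies the solvability of
Mantova–Masser's model system** `e^z + e^{z²-w²} = z, e^w + e^{z²-w²} = -w`. [folklore] -/
theorem mantovaMasserModel_inter_expGraph_nonempty_of_ecCellAperiodic (h : ECCellAperiodic 2) :
    (mantovaMasserModel ∩ expGraph ℂ 3).Nonempty := by
  obtain ⟨h1, h2, h4, h5, h6, h7, h8⟩ := ecCellAperiodic_hypotheses_mantovaMasserModel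
  exact h _ h1 h2 h4 h5 h6 h7 h8

/-- The mismatch paraboloid `x₃ = -x₁² - x₂², y₁ = x₁ + y₃, y₂ = x₂ + y₃` satisfies every
hypothesis of `ECCellAperiodic 2`. [folklore] -/
theorem ecCellAperiodic_hypotheses_mismatchParaboloidModel :
    IsIrreducibleClosed ℂ mismatchParaboloidModel ∧
    (mismatchParaboloidModel ∩ torusLocus ℂ 3).Nonempty ∧
    IsAddFree ℂ 3 (mismatchParaboloidModel ∩ torusLocus ℂ 3) ∧
    IsMulFree ℂ 3 (mismatchParaboloidModel ∩ torusLocus ℂ 3) ∧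
    zariskiDim ℂ mismatchParaboloidModel = (3 : ℕ) ∧
    addProjDim ℂ 3 mismatchParaboloidModel = (2 : ℕ) ∧
    ¬ HasIntegerPeriod ℂ (projAdd '' (mismatchParaboloidModel ∩ torusLocus ℂ 3)) := by
  obtain ⟨⟨h1, h2, -, h4, h5, h6, h7⟩, -⟩ := ecCell_hypotheses_mismatchParaboloidModel
  refine ⟨h1, h2, h4, h5, h6, h7, ?_⟩
  rw [show mismatchParaboloidModel = decoupledGraph (-X 0 ^ 2 - X 1 ^ 2 : MvPolynomial (Fin 2) ℂ)
      ![1, 1] ![0, 0] ![1, 1] from rfl,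
    hasIntegerPeriod_projAdd_decoupledGraph_iff _ _ _ _ pp_ha]
  exact not_hasIntegerPeriod_graphBase_mismatch

/-- `ECCellAperiodic 2` implies that the mismatch paraboloid meets the graph of `exp`. [folklore] -/
theorem mismatchParaboloidModel_inter_expGraph_nonempty_of_ecCellAperiodic (h : ECCellAperiodic 2) :
    (mismatchParaboloidModel ∩ expGraph ℂ 3).Nonempty := by
  obtain ⟨h1, h2, h4, h5, h6, h7, h8⟩ := ecCellAperiodic_hypotheses_mismatchParaboloidModel
  exact h _ h1 h2 h4 h5 h6 h7 h8

/-- The imaginary-quadric model `x₃ = i x₁ x₂, y₁ = x₁ - y₃, y₂ = x₂ - y₃` satisfies every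
hypothesis of `ECCellAperiodic 2`. [folklore] -/
theorem ecCellAperiodic_hypotheses_imaginaryQuadricModel :
    IsIrreducibleClosed ℂ imaginaryQuadricModel ∧
    (imaginaryQuadricModel ∩ torusLocus ℂ 3).Nonempty ∧
    IsAddFree ℂ 3 (imaginaryQuadricModel ∩ torusLocus ℂ 3) ∧
    IsMulFree ℂ 3 (imaginaryQuadricModel ∩ torusLocus ℂ 3) ∧
    zariskiDim ℂ imaginaryQuadricModel = (3 : ℕ) ∧
    addProjDim ℂ 3 imaginaryQuadricModel = (2 : ℕ) ∧
    ¬ HasIntegerPeriod ℂ (projAdd '' (imaginaryQuadricModel ∩ torusLocus ℂ 3)) := by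
  obtain ⟨⟨h1, h2, -, h4, h5, h6, h7⟩, -⟩ := ecCell_hypotheses_imaginaryQuadricModel
  refine ⟨h1, h2, h4, h5, h6, h7, ?_⟩
  rw [show imaginaryQuadricModel = decoupledGraph (C Complex.I * X 0 * X 1 : MvPolynomial (Fin 2) ℂ)
      ![1, 1] ![0, 0] ![-1, -1] from rfl,
    hasIntegerPeriod_projAdd_decoupledGraph_iff _ _ _ _ pp_ha]
  exact not_hasIntegerPeriod_graphBase_imaginary

/-- `ECCellAperiodic 2` implies the solvability of the imaginary-quadric model system. [folklore] -/
theorem imaginaryQuadricModel_inter_expGraph_nonempty_of_ecCellAperiodic (h : ECCellAperiodic 2) :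
    (imaginaryQuadricModel ∩ expGraph ℂ 3).Nonempty := by
  obtain ⟨h1, h2, h4, h5, h6, h7, h8⟩ := ecCellAperiodic_hypotheses_imaginaryQuadricModel
  exact h _ h1 h2 h4 h5 h6 h7 h8

/-- The cubic model `x₃ = x₁³ + x₂³, y₁ = x₁ - y₃, y₂ = -x₂ - y₃` satisfies every hypothesis of
`ECCellAperiodic 2`. [folklore] -/
theorem ecCellAperiodic_hypotheses_cubicOscillatoryModel :
    IsIrreducibleClosed ℂ cubicOscillatoryModel ∧
    (cubicOscillatoryModel ∩ torusLocus ℂ 3).Nonempty ∧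
    IsAddFree ℂ 3 (cubicOscillatoryModel ∩ torusLocus ℂ 3) ∧
    IsMulFree ℂ 3 (cubicOscillatoryModel ∩ torusLocus ℂ 3) ∧
    zariskiDim ℂ cubicOscillatoryModel = (3 : ℕ) ∧
    addProjDim ℂ 3 cubicOscillatoryModel = (2 : ℕ) ∧
    ¬ HasIntegerPeriod ℂ (projAdd '' (cubicOscillatoryModel ∩ torusLocus ℂ 3)) := by
  obtain ⟨⟨h1, h2, -, h4, h5, h6, h7⟩, -⟩ := ecCell_hypotheses_cubicOscillatoryModel
  refine ⟨h1, h2, h4, h5, h6, h7, ?_⟩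
  rw [show cubicOscillatoryModel = decoupledGraph (X 0 ^ 3 + X 1 ^ 3 : MvPolynomial (Fin 2) ℂ)
      ![1, -1] ![0, 0] ![-1, -1] from rfl,
    hasIntegerPeriod_projAdd_decoupledGraph_iff _ _ _ _ mm_ha]
  exact not_hasIntegerPeriod_graphBase_cubic

/-- `ECCellAperiodic 2` implies the solvability of the cubic model system. [folklore] -/
theorem cubicOscillatoryModel_inter_expGraph_nonempty_of_ecCellAperiodic (h : ECCellAperiodic 2) :
    (cubicOscillatoryModel ∩ expGraph ℂ 3).Nonempty := by
  obtain ⟨h1, h2, h4, h5, h6, h7, h8⟩ := ecCellAperiodic_hypotheses_cubicOscillatoryModel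
  exact h _ h1 h2 h4 h5 h6 h7 h8

end Models

/-! ### A certified member of the PERIODIC sub-cell -/

section PeriodicMember

/-- `x₃ = x₁²` (a parabolic cylinder) has the integer period `(0, 1, 0)`. [folklore] -/
theorem hasIntegerPeriod_graphBase_X_sq :
    HasIntegerPeriod ℂ (graphBase (X 0 ^ 2 : MvPolynomial (Fin 2) ℂ)) := by
  rw [hasIntegerPeriod_graphBase_iff]
  refine ⟨![0, 1, 0], fun h0 => by simpa using congrFun h0 1, ?_⟩
  have hc0 : (Fin.castSucc (0 : Fin 2) : Fin 3) = 0 := rfl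
  have hl : (Fin.last 2 : Fin 3) = 2 := rfl
  simp only [map_pow, transl_X, hc0, hl, Matrix.cons_val_zero, Matrix.cons_val_two,
    Matrix.tail_cons, Matrix.head_cons, Int.cast_zero, C_0, add_zero]

/-- The **parabolic-cylinder model** `x₃ = x₁², y₁ = x₁ - y₃, y₂ = x₂ - y₃` (system
`e^z + e^{z²} = z, e^w + e^{z²} = w`): a decoupled-graph variety whose base `x₃ = x₁²` is a
cylinder in the `x₂`-direction — a member of the PERIODIC sub-cell. [folklore] -/
def parabolicCylinderModel : Set (Fin 3 ⊕ Fin 3 → ℂ) :=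
  decoupledGraph (X 0 ^ 2 : MvPolynomial (Fin 2) ℂ) ![1, 1] ![0, 0] ![-1, -1]

/-- **The parabolic-cylinder model satisfies every hypothesis of `ECCellPeriodic 2`** — in the
binder order of that cell: irreducible closed, meets `G³`, rotund (here from the dominant
multiplicative projection, `EACRotundityProofs.isRotund_decoupledGraph`), additively free,
multiplicatively free, `dim = 3`, `addProjDim = 2`, base PERIODIC. So both sub-cells of the open
rung `(3, 2)` contain certified explicit members. [folklore] -/
theorem ecCellPeriodic_hypotheses_parabolicCylinderModel :
    IsIrreducibleClosed ℂ parabolicCylinderModel ∧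
    (parabolicCylinderModel ∩ torusLocus ℂ 3).Nonempty ∧
    IsRotund ℂ 3 (parabolicCylinderModel ∩ torusLocus ℂ 3) ∧
    IsAddFree ℂ 3 (parabolicCylinderModel ∩ torusLocus ℂ 3) ∧
    IsMulFree ℂ 3 (parabolicCylinderModel ∩ torusLocus ℂ 3) ∧
    zariskiDim ℂ parabolicCylinderModel = (3 : ℕ) ∧
    addProjDim ℂ 3 parabolicCylinderModel = (2 : ℕ) ∧
    HasIntegerPeriod ℂ (projAdd '' (parabolicCylinderModel ∩ torusLocus ℂ 3)) := by
  obtain ⟨h1, h2, h3, h4, h5, h6, h7⟩ :=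
    ecCell_hypotheses_decoupledGraph (X 0 ^ 2 : MvPolynomial (Fin 2) ℂ) ![1, 1] ![0, 0] ![-1, -1]
      pp_ha (by rw [totalDegree_X_pow])
  refine ⟨h1, h2, h3, h4, h5, h6, h7, ?_⟩
  rw [show parabolicCylinderModel = decoupledGraph (X 0 ^ 2 : MvPolynomial (Fin 2) ℂ)
      ![1, 1] ![0, 0] ![-1, -1] from rfl,
    hasIntegerPeriod_projAdd_decoupledGraph_iff _ _ _ _ pp_ha]
  exact hasIntegerPeriod_graphBase_X_sq

/-- `ECCellPeriodic 2` (the periodic open sub-rung) implies that the parabolic-cylinder model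
meets the graph of `exp`. [folklore] -/
theorem parabolicCylinderModel_inter_expGraph_nonempty_of_ecCellPeriodic (h : ECCellPeriodic 2) :
    (parabolicCylinderModel ∩ expGraph ℂ 3).Nonempty := by
  obtain ⟨h1, h2, h3, h4, h5, h6, h7, h8⟩ := ecCellPeriodic_hypotheses_parabolicCylinderModel
  exact h _ h1 h2 h3 h4 h5 h6 h7 h8

/-- **The parabolic-cylinder model system**: exponential points of `parabolicCylinderModel` ↔
solutions of `e^z + e^{z²} = z`, `e^w + e^{z²} = w`. [folklore] -/
theorem parabolicCylinderModel_inter_expGraph_nonempty_iff :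
    (parabolicCylinderModel ∩ expGraph ℂ 3).Nonempty ↔
      ∃ z w : ℂ, Complex.exp z + Complex.exp (z ^ 2) = z ∧
        Complex.exp w + Complex.exp (z ^ 2) = w := by
  rw [parabolicCylinderModel, decoupledGraph_inter_expGraph_nonempty_iff, exists_fin_two_fun_iff]
  refine exists_congr fun z => exists_congr fun w => ?_
  simp only [Fin.forall_fin_two, map_pow, eval_X, Matrix.cons_val_zero, Matrix.cons_val_one]
  constructor
  · rintro ⟨h1, h2⟩
    exact ⟨by linear_combination h1, by linear_combination h2⟩
  · rintro ⟨h1, h2⟩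
    exact ⟨by linear_combination h1, by linear_combination h2⟩

end PeriodicMember

/-! ### Hyperplane bases: the degree-one membership certificate -/

section Hyperplane

variable {s : ℕ}

/-- **Additive freeness over a hyperplane base with an irrational coefficient.** If
`I(π(V)) = ker (X_{s+1} ↦ Σ rᵢ Xᵢ + c)` and some `rⱼ ∉ ℚ`, then no nonzero integer form
`Σ mᵢ xᵢ` is constant on `V`: evaluating `Σ_{i ≤ s} mᵢ xᵢ + m_{s+1} ℓ(x) - c'` (which vanishes
identically) at `0` and at `eⱼ` gives `mⱼ + m_{s+1} rⱼ = 0` for all `j`, so either `m = 0` or every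
`rⱼ = -mⱼ / m_{s+1} ∈ ℚ`. (The `deg g ≥ 2` analogue is
`EACRotundityProofs.isAddFree_of_vanishingIdeal_projAdd_eq_ker`.) [folklore] -/
theorem isAddFree_of_vanishingIdeal_projAdd_eq_ker_linear (r : Fin s → ℂ) (c : ℂ)
    {V : Set (Fin (s + 1) ⊕ Fin (s + 1) → ℂ)}
    (hV : vanishingIdeal ℂ (projAdd '' V) = RingHom.ker (aeval (graphSubst (∑ i, C (r i) * X i + C c)) :
        MvPolynomial (Fin (s + 1)) ℂ →ₐ[ℂ] MvPolynomial (Fin s) ℂ))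
    (hr : ∃ j, ∀ q : ℚ, r j ≠ (q : ℂ)) : IsAddFree ℂ (s + 1) V := by
  classical
  rintro m hm ⟨c', hc'⟩
  set g : MvPolynomial (Fin s) ℂ := ∑ i, C (r i) * X i + C c with hgdef
  let ℓ : MvPolynomial (Fin (s + 1)) ℂ := (∑ i, C ((m i : ℤ) : ℂ) * X i) - C c'
  have hℓ : ℓ ∈ vanishingIdeal ℂ (projAdd '' V) := by
    rw [mem_vanishingIdeal_iff]
    rintro _ ⟨z, hz, rfl⟩
    have := hc' z hz
    simp only [ℓ, map_sub, map_sum, map_mul, aeval_C, aeval_X, projAdd_apply, sub_eq_zero]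
    simpa using this
  rw [hV, RingHom.mem_ker] at hℓ
  -- the identity `Σ_{j<s} mⱼ xⱼ + m_last * g(x) - c' = 0` for all `x`
  have hx : ∀ x : Fin s → ℂ,
      (∑ j : Fin s, (m (Fin.castSucc j) : ℂ) * x j) + (m (Fin.last s) : ℂ) * eval x g - c' = 0 := by
    intro x
    have h0 := congrArg (eval x) hℓ
    rw [eval_aeval_graphSubst, map_zero] at h0
    simp only [ℓ, map_sub, aeval_C, Fin.sum_univ_castSucc] at h0
    simpa using h0
  have hg0 : eval (0 : Fin s → ℂ) g = c := by simp [hgdef]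
  have hgj : ∀ j : Fin s, eval (Pi.single j 1 : Fin s → ℂ) g = r j + c := by
    intro j
    simp only [hgdef, map_add, map_sum, map_mul, eval_C, eval_X, Pi.single_apply, mul_ite, mul_one,
      mul_zero, Finset.sum_ite_eq', Finset.mem_univ, if_true]
  -- `mⱼ + m_last rⱼ = 0`
  have hrel : ∀ j : Fin s, (m (Fin.castSucc j) : ℂ) + (m (Fin.last s) : ℂ) * r j = 0 := by
    intro j
    have h1 := hx (Pi.single j 1)
    have h0 := hx 0
    simp only [Pi.zero_apply, mul_zero, Finset.sum_const_zero, zero_add, hg0] at h0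
    simp only [Pi.single_apply, mul_ite, mul_one, mul_zero, Finset.sum_ite_eq', Finset.mem_univ,
      if_true, hgj] at h1
    linear_combination h1 - h0
  by_cases hlast : m (Fin.last s) = 0
  · apply hm
    funext i
    induction i using Fin.lastCases with
    | last => exact hlast
    | cast j =>
      have h1 := hrel j
      rw [hlast, Int.cast_zero, zero_mul, add_zero] at h1
      exact_mod_cast h1
  · obtain ⟨j, hj⟩ := hr
    have hmc : ((m (Fin.last s) : ℤ) : ℂ) ≠ 0 := by exact_mod_cast hlast
    apply hj (-(m (Fin.castSucc j) : ℚ) / (m (Fin.last s) : ℚ))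
    have h1 := hrel j
    push_cast
    field_simp
    linear_combination h1

/-- **`W(ℓ; A, F)` over a hyperplane base `x_{s+1} = Σ rᵢ xᵢ + c` with some `rⱼ ∉ ℚ` satisfies
every hypothesis of the cell `(s + 1, s)`** (`A` dominant; fibres `yⱼ = Aⱼ(x') + y_{s+1} Fⱼ(y_{s+1}, x')`
arbitrary) — the degree-one counterpart of `ecCell_hypotheses_polyFibredGraph`, covering the shape
of the real-hyperplane family of `Summits/Schanuel/Schanuel/Theorems/ZilberEacComplexRealHyperplane`.
Such bases are periodic or not according to `hasIntegerPeriod_graphBase_linear_iff`. [folklore] -/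
theorem ecCell_hypotheses_polyFibredGraph_linear (r : Fin s → ℂ) (c : ℂ)
    (A : Fin s → MvPolynomial (Fin s) ℂ) (F : Fin s → MvPolynomial (Fin (s + 1)) ℂ)
    (hA : Function.Injective (aeval A : MvPolynomial (Fin s) ℂ →ₐ[ℂ] MvPolynomial (Fin s) ℂ))
    (hr : ∃ j, ∀ q : ℚ, r j ≠ (q : ℂ)) :
    IsIrreducibleClosed ℂ (polyFibredGraph (∑ i, C (r i) * X i + C c) A F) ∧
    (polyFibredGraph (∑ i, C (r i) * X i + C c) A F ∩ torusLocus ℂ (s + 1)).Nonempty ∧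
    IsRotund ℂ (s + 1) (polyFibredGraph (∑ i, C (r i) * X i + C c) A F ∩ torusLocus ℂ (s + 1)) ∧
    IsAddFree ℂ (s + 1) (polyFibredGraph (∑ i, C (r i) * X i + C c) A F ∩ torusLocus ℂ (s + 1)) ∧
    IsMulFree ℂ (s + 1) (polyFibredGraph (∑ i, C (r i) * X i + C c) A F ∩ torusLocus ℂ (s + 1)) ∧
    zariskiDim ℂ (polyFibredGraph (∑ i, C (r i) * X i + C c) A F) = (s + 1 : ℕ) ∧
    addProjDim ℂ (s + 1) (polyFibredGraph (∑ i, C (r i) * X i + C c) A F) = (s : ℕ) :=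
  ⟨isIrreducibleClosed_polyFibredGraph _ A F, polyFibredGraph_inter_torusLocus_nonempty _ A F hA,
    isRotund_polyFibredGraph _ A F hA,
    isAddFree_of_vanishingIdeal_projAdd_eq_ker_linear r c
      (vanishingIdeal_projAdd_polyFibredGraph _ A F hA) hr,
    isMulFree_polyFibredGraph _ A F hA, zariskiDim_polyFibredGraph _ A F,
    addProjDim_polyFibredGraph _ A F hA⟩

/-- **`ECCell (s+1) s` implies that `W(ℓ; A, F)` meets the graph of `exp`** (hyperplane base with
an irrational coefficient, `A` dominant). [folklore] -/
theorem polyFibredGraph_linear_inter_expGraph_nonempty_of_ecCell (r : Fin s → ℂ) (c : ℂ)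
    (A : Fin s → MvPolynomial (Fin s) ℂ) (F : Fin s → MvPolynomial (Fin (s + 1)) ℂ)
    (hA : Function.Injective (aeval A : MvPolynomial (Fin s) ℂ →ₐ[ℂ] MvPolynomial (Fin s) ℂ))
    (hr : ∃ j, ∀ q : ℚ, r j ≠ (q : ℂ)) (h : ECCell (s + 1) s) :
    (polyFibredGraph (∑ i, C (r i) * X i + C c) A F ∩ expGraph ℂ (s + 1)).Nonempty := by
  obtain ⟨h1, h2, h3, h4, h5, h6, h7⟩ := ecCell_hypotheses_polyFibredGraph_linear r c A F hA hr
  exact h _ h1 h2 h3 h4 h5 h6 h7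

end Hyperplane

/-! ### The `√2`-hyperplane model of the real-hyperplane family: a certified periodic member -/

section SqrtTwoModel

/-- **Dominance from surjectivity.** If the polynomial map `x ↦ (A₁(x), …, Aₛ(x)) : ℂˢ → ℂˢ` is
surjective, then the substitution `Xⱼ ↦ Aⱼ` is injective (a polynomial killed by it vanishes on the
image, i.e. everywhere). [folklore] -/
theorem aeval_injective_of_surjective {s : ℕ} (A : Fin s → MvPolynomial (Fin s) ℂ)
    (h : Function.Surjective fun x : Fin s → ℂ => fun j => eval x (A j)) :
    Function.Injective (aeval A : MvPolynomial (Fin s) ℂ →ₐ[ℂ] MvPolynomial (Fin s) ℂ) := by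
  rw [injective_iff_map_eq_zero]
  intro p hp
  apply MvPolynomial.funext
  intro y
  obtain ⟨x, rfl⟩ := h y
  have h1 : aeval x (aeval A p) = 0 := by rw [hp, map_zero]
  rw [← AlgHom.comp_apply, comp_aeval] at h1
  simpa using h1

/-- The substitution `(X₀, X₁) ↦ (X₀, X₁²)` is injective (every complex number is a square).
[folklore] -/
theorem aeval_X_Xsq_injective :
    Function.Injective (aeval ![(X 0 : MvPolynomial (Fin 2) ℂ), X 1 ^ 2] :
      MvPolynomial (Fin 2) ℂ →ₐ[ℂ] MvPolynomial (Fin 2) ℂ) := by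
  refine aeval_injective_of_surjective _ fun y => ?_
  obtain ⟨z, hz⟩ := IsAlgClosed.exists_pow_nat_eq (y 1) (by norm_num : 0 < 2)
  refine ⟨![y 0, z], funext fun j => ?_⟩
  fin_cases j
  · simp
  · simp [hz]

/-- `√2` is not (the image of) a rational number in `ℂ`. [folklore] -/
theorem exists_sqrtTwoCoeff_ne_ratCast :
    ∃ j : Fin 2, ∀ q : ℚ, (![(Real.sqrt 2 : ℂ), -1]) j ≠ (q : ℂ) := by
  refine ⟨0, fun q h => ?_⟩
  simp only [Matrix.cons_val_zero] at h
  have h' : (Real.sqrt 2 : ℝ) = (q : ℝ) := by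
    have : ((Real.sqrt 2 : ℝ) : ℂ) = ((q : ℝ) : ℂ) := by rw [h, Complex.ofReal_ratCast]
    exact_mod_cast this
  exact irrational_sqrt_two ⟨q, h'.symm⟩

/-- The **`√2`-hyperplane model** `x₃ = √2 x₁ - x₂, y₁ = x₁ + y₃, y₂ = x₂² + y₃` of the
real-hyperplane family (`Summits/Schanuel/Schanuel/Theorems/ZilberEacComplexRealHyperplane`,
system `e^z = z + e^{√2 z - w}, e^w = w² + e^{√2 z - w}`), as a `polyFibredGraph` over the
hyperplane `Σ rᵢ xᵢ + c` with `r = (√2, -1)`, `c = 0`, `A = (X₀, X₁²)`, `F = (1, 1)`. [folklore] -/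
def sqrtTwoHyperplaneModel : Set (Fin 3 ⊕ Fin 3 → ℂ) :=
  polyFibredGraph (∑ i, C (![(Real.sqrt 2 : ℂ), -1] i) * X i + C 0)
    ![(X 0 : MvPolynomial (Fin 2) ℂ), X 1 ^ 2] ![1, 1]

/-- **The `√2`-hyperplane model satisfies every hypothesis of `ECCell 3 2`.** [folklore] -/
theorem ecCell_hypotheses_sqrtTwoHyperplaneModel :
    IsIrreducibleClosed ℂ sqrtTwoHyperplaneModel ∧
    (sqrtTwoHyperplaneModel ∩ torusLocus ℂ 3).Nonempty ∧
    IsRotund ℂ 3 (sqrtTwoHyperplaneModel ∩ torusLocus ℂ 3) ∧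
    IsAddFree ℂ 3 (sqrtTwoHyperplaneModel ∩ torusLocus ℂ 3) ∧
    IsMulFree ℂ 3 (sqrtTwoHyperplaneModel ∩ torusLocus ℂ 3) ∧
    zariskiDim ℂ sqrtTwoHyperplaneModel = (3 : ℕ) ∧
    addProjDim ℂ 3 sqrtTwoHyperplaneModel = (2 : ℕ) :=
  ecCell_hypotheses_polyFibredGraph_linear _ _ _ _ aeval_X_Xsq_injective
    exists_sqrtTwoCoeff_ne_ratCast

/-- The base `x₃ = √2 x₁ - x₂` of the `√2`-hyperplane model is PERIODIC (period `(0, 1, -1)`).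
[folklore] -/
theorem hasIntegerPeriod_sqrtTwoHyperplaneModel :
    HasIntegerPeriod ℂ (projAdd '' (sqrtTwoHyperplaneModel ∩ torusLocus ℂ 3)) := by
  rw [sqrtTwoHyperplaneModel, hasIntegerPeriod_projAdd_polyFibredGraph_iff _ _ _ aeval_X_Xsq_injective,
    hasIntegerPeriod_graphBase_linear_iff]
  refine ⟨![0, 1, -1], fun h0 => by simpa using congrFun h0 1, ?_⟩
  have hc0 : (Fin.castSucc (0 : Fin 2) : Fin 3) = 0 := rfl
  have hc1 : (Fin.castSucc (1 : Fin 2) : Fin 3) = 1 := rfl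
  have hl : (Fin.last 2 : Fin 3) = 2 := rfl
  simp only [Fin.sum_univ_two, hc0, hc1, hl, Matrix.cons_val_zero, Matrix.cons_val_one,
    Matrix.cons_val_two, Matrix.tail_cons, Matrix.head_cons]
  push_cast
  ring

/-- **The `√2`-hyperplane model satisfies every hypothesis of `ECCellPeriodic 2`** — a certified
member of the PERIODIC sub-cell whose system is SOLVED in the tree
(`Summit.Schanuel.Schanuel.Theorems.sqrt_two_hyperplane_model_system_solvable`, seat 2, Thm R).
[folklore] -/
theorem ecCellPeriodic_hypotheses_sqrtTwoHyperplaneModel :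
    IsIrreducibleClosed ℂ sqrtTwoHyperplaneModel ∧
    (sqrtTwoHyperplaneModel ∩ torusLocus ℂ 3).Nonempty ∧
    IsRotund ℂ 3 (sqrtTwoHyperplaneModel ∩ torusLocus ℂ 3) ∧
    IsAddFree ℂ 3 (sqrtTwoHyperplaneModel ∩ torusLocus ℂ 3) ∧
    IsMulFree ℂ 3 (sqrtTwoHyperplaneModel ∩ torusLocus ℂ 3) ∧
    zariskiDim ℂ sqrtTwoHyperplaneModel = (3 : ℕ) ∧
    addProjDim ℂ 3 sqrtTwoHyperplaneModel = (2 : ℕ) ∧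
    HasIntegerPeriod ℂ (projAdd '' (sqrtTwoHyperplaneModel ∩ torusLocus ℂ 3)) := by
  obtain ⟨h1, h2, h3, h4, h5, h6, h7⟩ := ecCell_hypotheses_sqrtTwoHyperplaneModel
  exact ⟨h1, h2, h3, h4, h5, h6, h7, hasIntegerPeriod_sqrtTwoHyperplaneModel⟩

/-- `ECCellPeriodic 2` implies that the `√2`-hyperplane model meets the graph of `exp`.
[folklore] -/
theorem sqrtTwoHyperplaneModel_inter_expGraph_nonempty_of_ecCellPeriodic (h : ECCellPeriodic 2) :
    (sqrtTwoHyperplaneModel ∩ expGraph ℂ 3).Nonempty := by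
  obtain ⟨h1, h2, h3, h4, h5, h6, h7, h8⟩ := ecCellPeriodic_hypotheses_sqrtTwoHyperplaneModel
  exact h _ h1 h2 h3 h4 h5 h6 h7 h8

/-- **The `√2`-hyperplane model system**: exponential points of `sqrtTwoHyperplaneModel` ↔
solutions of `e^z = z + e^{√2 z - w}`, `e^w = w² + e^{√2 z - w}` (the statement shape of
`sqrt_two_hyperplane_model_system_solvable`). [folklore] -/
theorem sqrtTwoHyperplaneModel_inter_expGraph_nonempty_iff :
    (sqrtTwoHyperplaneModel ∩ expGraph ℂ 3).Nonempty ↔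
      ∃ z w : ℂ, Complex.exp z = z + Complex.exp (Real.sqrt 2 * z - w) ∧
        Complex.exp w = w ^ 2 + Complex.exp (Real.sqrt 2 * z - w) := by
  rw [sqrtTwoHyperplaneModel, polyFibredGraph_inter_expGraph_nonempty_iff, exists_fin_two_fun_iff]
  refine exists_congr fun z => exists_congr fun w => ?_
  have key : eval ![z, w] (∑ i, C (![(Real.sqrt 2 : ℂ), -1] i) * X i + C 0 :
      MvPolynomial (Fin 2) ℂ) = Real.sqrt 2 * z - w := by
    simp only [map_add, map_mul, eval_C, eval_X, Fin.sum_univ_two, Matrix.cons_val_zero,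
      Matrix.cons_val_one]
    ring
  simp only [Fin.forall_fin_two, key, map_pow, map_one, eval_X, Matrix.cons_val_zero,
    Matrix.cons_val_one, mul_one]

end SqrtTwoModel

/-! ### Seat 2's quadric escape family straddles the split -/

section EscapeFamily

variable {s : ℕ}

/-- The diagonal quadric `Σ aᵢXᵢ² + Σ bᵢXᵢ + c₀` as an `MvPolynomial`. [folklore] -/
def diagQuadric (a b : Fin s → ℂ) (c₀ : ℂ) : MvPolynomial (Fin s) ℂ :=
  ∑ i, C (a i) * X i ^ 2 + ∑ i, C (b i) * X i + C c₀

/-- Its evaluation is seat 2's `Σ aᵢxᵢ² + Σ bᵢxᵢ + c₀`. [folklore] -/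
@[simp] theorem eval_diagQuadric (a b : Fin s → ℂ) (c₀ : ℂ) (x : Fin s → ℂ) :
    eval x (diagQuadric a b c₀) = ∑ i, a i * x i ^ 2 + ∑ i, b i * x i + c₀ := by
  simp only [diagQuadric, map_add, map_sum, map_mul, map_pow, eval_C, eval_X]

/-- The coefficient of `Xᵢ²` in the diagonal quadric is `aᵢ`. [folklore] -/
theorem coeff_single_two_diagQuadric (a b : Fin s → ℂ) (c₀ : ℂ) (i : Fin s) :
    coeff (Finsupp.single i 2) (diagQuadric a b c₀) = a i := by
  classical
  have hq : ∀ j, coeff (Finsupp.single i 2) (C (a j) * X j ^ 2 : MvPolynomial (Fin s) ℂ) =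
      if j = i then a i else 0 := by
    intro j
    rw [X_pow_eq_monomial, C_mul_monomial, mul_one, coeff_monomial]
    by_cases hj : j = i
    · subst hj; simp
    · rw [if_neg, if_neg hj]
      intro h
      exact hj ((Finsupp.single_left_inj (two_ne_zero)).1 h)
  have hl : ∀ j, coeff (Finsupp.single i 2) (C (b j) * X j : MvPolynomial (Fin s) ℂ) = 0 := by
    intro j
    rw [coeff_C_mul, coeff_X, if_neg, mul_zero]
    intro h
    rcases (Finsupp.single_eq_single_iff _ _ _ _).1 h with ⟨_, h12⟩ | ⟨h10, _⟩
    · exact absurd h12 (by decide)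
    · exact absurd h10 (by decide)
  have hc : coeff (Finsupp.single i 2) (C c₀ : MvPolynomial (Fin s) ℂ) = 0 := by
    rw [coeff_C, if_neg]
    intro h
    have := Finsupp.ext_iff.1 h i
    simp at this
  simp only [diagQuadric, coeff_add, coeff_sum, hq, hl, hc, Finset.sum_const_zero, add_zero,
    Finset.sum_ite_eq', Finset.mem_univ, if_true]

/-- If some `aᵢ ≠ 0` the diagonal quadric has total degree at least `2`. [folklore] -/
theorem two_le_totalDegree_diagQuadric (a b : Fin s → ℂ) (c₀ : ℂ) (i : Fin s) (hi : a i ≠ 0) :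
    2 ≤ (diagQuadric a b c₀).totalDegree := by
  have hmem : Finsupp.single i 2 ∈ (diagQuadric a b c₀).support := by
    rw [mem_support_iff, coeff_single_two_diagQuadric]
    exact hi
  have := le_totalDegree hmem
  simpa using this

/-- **Seat 2's escape variety** `{x_{s+1} = Σ aᵢxᵢ² + Σ bᵢxᵢ + c₀, yⱼ = cⱼ y_{s+1} + Aⱼ(x′)}`
(`Summit.Schanuel.Schanuel.Theorems.quadricEscape_inter_expGraph_nonempty`), presented as the
poly-fibred graph `W(g; A, F)` with constant `Fⱼ = cⱼ`. [cite: MantovaMasser2023, §1 p. 5] -/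
def quadricEscapeVariety (a b : Fin s → ℂ) (c₀ : ℂ) (c : Fin s → ℂ)
    (A : Fin s → MvPolynomial (Fin s) ℂ) : Set (Fin (s + 1) ⊕ Fin (s + 1) → ℂ) :=
  polyFibredGraph (diagQuadric a b c₀) A (fun j => C (c j))

/-- `quadricEscapeVariety` is, as a set, EXACTLY the set-builder set of seat 2's theorem.
[folklore] -/
theorem quadricEscapeVariety_eq (a b : Fin s → ℂ) (c₀ : ℂ) (c : Fin s → ℂ)
    (A : Fin s → MvPolynomial (Fin s) ℂ) :
    quadricEscapeVariety a b c₀ c A =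
      {z : Fin (s + 1) ⊕ Fin (s + 1) → ℂ |
        z (Sum.inl (Fin.last s)) = ∑ i, a i * z (Sum.inl (Fin.castSucc i)) ^ 2 +
          ∑ i, b i * z (Sum.inl (Fin.castSucc i)) + c₀ ∧
        ∀ j : Fin s, z (Sum.inr (Fin.castSucc j)) =
          c j * z (Sum.inr (Fin.last s)) + eval (fun i => z (Sum.inl (Fin.castSucc i))) (A j)} := by
  ext z
  simp only [quadricEscapeVariety, mem_polyFibredGraph_iff, eval_diagQuadric, eval_C,
    Set.mem_setOf_eq]
  refine and_congr_right fun _ => forall_congr' fun j => ?_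
  constructor <;> intro h <;> rw [h] <;> ring

/-- **All `aᵢ ≠ 0`, `A` dominant ⇒ member of the rotundity-free sub-cell `ECCellAperiodic s`**
(the seven binders, in order): the base is aperiodic by
`EACQuadricBases.not_hasIntegerPeriod_graphBase_diagQuadric`, additive freeness is then automatic
(`EACAperiodicBase.isAddFree_of_not_hasIntegerPeriod`; `s ≥ 1` is needed — for `s = 0` the variety is
the vertical line `x₁ = c₀`, not additively free), the rest is `EACRotundityProofs`. [folklore] -/
theorem ecCellAperiodic_hypotheses_quadricEscapeVariety (a b : Fin s → ℂ) (c₀ : ℂ) (c : Fin s → ℂ)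
    (A : Fin s → MvPolynomial (Fin s) ℂ) (hs : 0 < s) (ha : ∀ i, a i ≠ 0)
    (hA : Function.Injective (aeval A : MvPolynomial (Fin s) ℂ →ₐ[ℂ] MvPolynomial (Fin s) ℂ)) :
    IsIrreducibleClosed ℂ (quadricEscapeVariety a b c₀ c A) ∧
    (quadricEscapeVariety a b c₀ c A ∩ torusLocus ℂ (s + 1)).Nonempty ∧
    IsAddFree ℂ (s + 1) (quadricEscapeVariety a b c₀ c A ∩ torusLocus ℂ (s + 1)) ∧
    IsMulFree ℂ (s + 1) (quadricEscapeVariety a b c₀ c A ∩ torusLocus ℂ (s + 1)) ∧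
    zariskiDim ℂ (quadricEscapeVariety a b c₀ c A) = (s + 1 : ℕ) ∧
    addProjDim ℂ (s + 1) (quadricEscapeVariety a b c₀ c A) = (s : ℕ) ∧
    ¬ HasIntegerPeriod ℂ (projAdd '' (quadricEscapeVariety a b c₀ c A ∩ torusLocus ℂ (s + 1))) := by
  have hper : ¬ HasIntegerPeriod ℂ
      (projAdd '' (quadricEscapeVariety a b c₀ c A ∩ torusLocus ℂ (s + 1))) := by
    rw [quadricEscapeVariety, hasIntegerPeriod_projAdd_polyFibredGraph_iff _ _ _ hA, diagQuadric]
    exact not_hasIntegerPeriod_graphBase_diagQuadric a b c₀ ha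
  have hirr := isIrreducibleClosed_polyFibredGraph (diagQuadric a b c₀) A (fun j => C (c j))
  have hne := polyFibredGraph_inter_torusLocus_nonempty (diagQuadric a b c₀) A (fun j => C (c j)) hA
  have hbase := addProjDim_polyFibredGraph (diagQuadric a b c₀) A (fun j => C (c j)) hA
  exact ⟨hirr, hne, isAddFree_of_not_hasIntegerPeriod hirr hne hs hbase hper,
    isMulFree_polyFibredGraph _ _ _ hA, zariskiDim_polyFibredGraph _ _ _, hbase, hper⟩

/-- Hence `ECCellAperiodic s` alone implies that every such escape variety meets the graph of `exp`
(what `exists_expPoint_quadricEscape` proves unconditionally for `Σ aᵢ ≠ 0`, `cⱼ ≠ 0`).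
[folklore] -/
theorem quadricEscapeVariety_inter_expGraph_nonempty_of_ecCellAperiodic (a b : Fin s → ℂ) (c₀ : ℂ)
    (c : Fin s → ℂ) (A : Fin s → MvPolynomial (Fin s) ℂ) (hs : 0 < s) (ha : ∀ i, a i ≠ 0)
    (hA : Function.Injective (aeval A : MvPolynomial (Fin s) ℂ →ₐ[ℂ] MvPolynomial (Fin s) ℂ))
    (h : ECCellAperiodic s) :
    (quadricEscapeVariety a b c₀ c A ∩ expGraph ℂ (s + 1)).Nonempty := by
  obtain ⟨h1, h2, h3, h4, h5, h6, h7⟩ :=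
    ecCellAperiodic_hypotheses_quadricEscapeVariety a b c₀ c A hs ha hA
  exact h _ h1 h2 h3 h4 h5 h6 h7

/-- **Some `aₖ = 0` with `bₖ ∈ ℤ`, some `aᵢ ≠ 0`, `A` dominant ⇒ member of the PERIODIC sub-cell
`ECCellPeriodic s`** (the eight binders, in order; rotundity from the dominant multiplicative
projection, `EACRotundityProofs.isRotund_polyFibredGraph`; the period is `eₖ + bₖ e_{s+1}`).
[folklore] -/
theorem ecCellPeriodic_hypotheses_quadricEscapeVariety (a b : Fin s → ℂ) (c₀ : ℂ) (c : Fin s → ℂ)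
    (A : Fin s → MvPolynomial (Fin s) ℂ)
    (hA : Function.Injective (aeval A : MvPolynomial (Fin s) ℂ →ₐ[ℂ] MvPolynomial (Fin s) ℂ))
    (i : Fin s) (hi : a i ≠ 0) (k : Fin s) (hk : a k = 0) (m : ℤ) (hm : b k = (m : ℂ)) :
    IsIrreducibleClosed ℂ (quadricEscapeVariety a b c₀ c A) ∧
    (quadricEscapeVariety a b c₀ c A ∩ torusLocus ℂ (s + 1)).Nonempty ∧
    IsRotund ℂ (s + 1) (quadricEscapeVariety a b c₀ c A ∩ torusLocus ℂ (s + 1)) ∧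
    IsAddFree ℂ (s + 1) (quadricEscapeVariety a b c₀ c A ∩ torusLocus ℂ (s + 1)) ∧
    IsMulFree ℂ (s + 1) (quadricEscapeVariety a b c₀ c A ∩ torusLocus ℂ (s + 1)) ∧
    zariskiDim ℂ (quadricEscapeVariety a b c₀ c A) = (s + 1 : ℕ) ∧
    addProjDim ℂ (s + 1) (quadricEscapeVariety a b c₀ c A) = (s : ℕ) ∧
    HasIntegerPeriod ℂ (projAdd '' (quadricEscapeVariety a b c₀ c A ∩ torusLocus ℂ (s + 1))) := by
  have hper : HasIntegerPeriod ℂ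
      (projAdd '' (quadricEscapeVariety a b c₀ c A ∩ torusLocus ℂ (s + 1))) := by
    rw [quadricEscapeVariety, hasIntegerPeriod_projAdd_polyFibredGraph_iff _ _ _ hA, diagQuadric]
    exact hasIntegerPeriod_graphBase_diagQuadric_of_eq_zero a b c₀ k hk m hm
  obtain ⟨h1, h2, h3, h4, h5, h6, h7⟩ := ecCell_hypotheses_polyFibredGraph (diagQuadric a b c₀) A
    (fun j => C (c j)) hA (two_le_totalDegree_diagQuadric a b c₀ i hi)
  exact ⟨h1, h2, h3, h4, h5, h6, h7, hper⟩

/-- Hence `ECCellPeriodic s` implies that these escape varieties meet the graph of `exp`.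
[folklore] -/
theorem quadricEscapeVariety_inter_expGraph_nonempty_of_ecCellPeriodic (a b : Fin s → ℂ) (c₀ : ℂ)
    (c : Fin s → ℂ) (A : Fin s → MvPolynomial (Fin s) ℂ)
    (hA : Function.Injective (aeval A : MvPolynomial (Fin s) ℂ →ₐ[ℂ] MvPolynomial (Fin s) ℂ))
    (i : Fin s) (hi : a i ≠ 0) (k : Fin s) (hk : a k = 0) (m : ℤ) (hm : b k = (m : ℂ))
    (h : ECCellPeriodic s) :
    (quadricEscapeVariety a b c₀ c A ∩ expGraph ℂ (s + 1)).Nonempty := by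
  obtain ⟨h1, h2, h3, h4, h5, h6, h7, h8⟩ :=
    ecCellPeriodic_hypotheses_quadricEscapeVariety a b c₀ c A hA i hi k hk m hm
  exact h _ h1 h2 h3 h4 h5 h6 h7 h8

/-- The exponential points of the escape variety are the solutions of seat 2's system
`exp xⱼ = cⱼ e^{g(x)} + Aⱼ(x)`. [folklore] -/
theorem quadricEscapeVariety_inter_expGraph_nonempty_iff (a b : Fin s → ℂ) (c₀ : ℂ) (c : Fin s → ℂ)
    (A : Fin s → MvPolynomial (Fin s) ℂ) :
    (quadricEscapeVariety a b c₀ c A ∩ expGraph ℂ (s + 1)).Nonempty ↔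
      ∃ x : Fin s → ℂ, ∀ j, Complex.exp (x j) =
        c j * Complex.exp (∑ i, a i * x i ^ 2 + ∑ i, b i * x i + c₀) + eval x (A j) := by
  rw [quadricEscapeVariety, polyFibredGraph_inter_expGraph_nonempty_iff]
  refine exists_congr fun x => forall_congr' fun j => ?_
  rw [eval_diagQuadric, eval_C]
  constructor <;> intro h <;> rw [h] <;> ring

end EscapeFamily

end Literature.ModelTheory.Zilber
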